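import Literature.Geometry.Riemannian.SphereNormalField
import Literature.Geometry.Riemannian.LevelSetNormalDerivative
import Mathlib.Analysis.InnerProductSpace.Calculus
import HarnessLib

/-!
# The second fundamental form of the round sphere for a chart metric

Topic `Geometry/Riemannian`. Continuing `SphereNormalField.lean`: for the unit sphere
`S = {‖x‖ = 1}` of the model open set `U : Opens V` with a Riemannian chart metric `g_U`
(components `G_U`), unit normal `ν = (√q)⁻¹ N`, `N = (G_U p)⁻¹⟪p, ·⟫`, `q = G_U(p)(N, N)`, and a
curve `γ` on `S` through `p = γ(0)` with velocity `X = γ'(0)`, the level-set formula of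
`LevelSetNormalDerivative.lean` (Lee 2018, Problem 8-2: `⟨D_X ν, X⟩ = Hess F(X, X)/|grad F|` for
`F = ‖x‖²`) gives

* `val_covariantDerivAlong_sphereNormal` —
  **`G_U(p)(D_s ν, X) = (√q)⁻¹ (‖X‖² - ⟪p, Γ_p(X)(X)⟫)`**;
* `neg_mul_val_le_val_covariantDerivAlong_sphereNormal` — hence, if
  `⟪p, Γ_p(X)(X)⟫ ≤ λ √q · G_U(p)(X, X)` on `S`, the curve form of **`II ≥ -λ`**:
  `-(λ G_U(X, X)) ≤ G_U(D_s ν, X)`, in exactly the shape of hypothesis `hII` of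
  `ConeExitDerivative.neg_mul_val_le_half_deriv_coneMap` (with `M := U` and the presentation
  `ι(v) = φ⁻¹(v/‖v‖)`).

This is step (2) of the proof of Weinstein's theorem in the round picture of the interior surgery
(Weinstein 1968): the boundary sphere of the disk has second fundamental form `≥ -λ`.

## References

* J. M. Lee, *Introduction to Riemannian Manifolds*, 2nd ed. (2018), Problem 8-2 and Example 8.25.
  [cite: LeeRiemannianManifolds2018, Problem 8-2]
* A. Weinstein, Ann. of Math. (2) 87 (1968), 29–41, proof of the main theorem, step (2).
  [cite: Weinstein1968]

Tags: [Sphere] [SecondFundamentalForm] [Weinstein1968]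
-/

noncomputable section

open Bundle Set Function Filter TopologicalSpace
open scoped Manifold ContDiff Topology RealInnerProductSpace

namespace Literature.Geometry.Riemannian

open Literature.Geometry.Lorentzian
open Literature.Geometry.Lorentzian.OpensChart

variable {V : Type*} [NormedAddCommGroup V] [InnerProductSpace ℝ V] [FiniteDimensional ℝ V]
  {U : Opens V}
  (gU : PseudoRiemannianMetric 𝓘(ℝ, V) ∞ V (TangentSpace 𝓘(ℝ, V) : U → Type _))
  (GU : V → V →L[ℝ] V →L[ℝ] ℝ)

omit [FiniteDimensional ℝ V] in
/-- `d(‖·‖²)_x Z = 2⟪x, Z⟫`. [folklore] -/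
theorem fderiv_norm_sq_apply_apply (x Z : V) :
    fderiv ℝ (fun y : V ↦ ‖y‖ ^ 2) x Z = 2 * ⟪x, Z⟫ := by
  rw [fderiv_norm_sq_apply]
  simp [two_smul, two_mul]

omit [FiniteDimensional ℝ V] in
/-- `d²(‖·‖²)_x (X, Y) = 2⟪X, Y⟫`. [folklore] -/
theorem fderiv_fderiv_norm_sq_apply (x X Y : V) :
    fderiv ℝ (fderiv ℝ (fun y : V ↦ ‖y‖ ^ 2)) x X Y = 2 * ⟪X, Y⟫ := by
  have hfun : fderiv ℝ (fun y : V ↦ ‖y‖ ^ 2) = ⇑((2 : ℝ) • (innerSL ℝ : V →L[ℝ] V →L[ℝ] ℝ)) := by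
    funext y
    ext Z
    rw [fderiv_norm_sq_apply_apply]
    simp [two_mul]
  rw [hfun, ContinuousLinearMap.fderiv]
  simp only [FunLike.coe_smul, Pi.smul_apply, smul_eq_mul, two_mul]
  rfl

omit [FiniteDimensional ℝ V] in
/-- **The velocity of a sphere curve read through the presentation**: for `γ` on the unit
sphere, `d/ds ι(γ s) = γ'(s)`. [folklore] -/
theorem velocity_spherePresentation_comp (u₀ : U) (hSU : ∀ w : V, ‖w‖ = 1 → w ∈ U) {γ γ' : ℝ → V}
    (hγ : ∀ s, HasDerivAt γ (γ' s) s) (hγn : ∀ s, ‖γ s‖ = 1) (t : ℝ) :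
    (velocity 𝓘(ℝ, V) (fun s ↦ (extChartAt 𝓘(ℝ, V) u₀).symm (‖γ s‖⁻¹ • γ s)) t : V) = γ' t := by
  have hγ0 : ∀ s, γ s ≠ 0 := fun s h ↦ by
    have := hγn s; rw [h, norm_zero] at this; exact zero_ne_one this
  have hγc : ∀ s, (((extChartAt 𝓘(ℝ, V) u₀).symm (‖γ s‖⁻¹ • γ s) : U) : V) = γ s := fun s ↦ by
    rw [coe_spherePresentation u₀ hSU (hγ0 s), hγn s, inv_one, one_smul]
  exact velocity_eq_of_hasDerivAt_coe (γ := fun s ↦ (extChartAt 𝓘(ℝ, V) u₀).symm (‖γ s‖⁻¹ • γ s))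
    hγc (hγ t)

set_option maxHeartbeats 400000 in
/-- **`G_U(p)(D_s ν, X) = (√q)⁻¹ (‖X‖² - ⟪p, Γ_p(X)(X)⟫)`** along a `C²` curve `γ` on the unit
sphere, `p = γ 0`, `X = γ' 0`, for the unit normal field `ν = (√q)⁻¹ (G_U)⁻¹⟪·, ·⟫` of
`SphereNormalField.lean` (level-set formula with `F = ‖x‖²`: `Hess F(X, X) = 2‖X‖² - 2⟪p, Γ(X, X)⟫`,
`dF(ν) = 2√q`, `G_U(ν, ν) = 1`). [cite: LeeRiemannianManifolds2018, Problem 8-2] -/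
theorem val_covariantDerivAlong_sphereNormal [gU.HasLeviCivita] (hG : ∀ y : U, gU.val y = GU y)
    (hgU : gU.IsRiemannian) (u₀ : U) (hSU : ∀ w : V, ‖w‖ = 1 → w ∈ U) {γ γ' : ℝ → V} {γ'' : V}
    (hγ : ∀ s, HasDerivAt γ (γ' s) s) (hγ' : HasDerivAt γ' γ'' 0) (hγn : ∀ s, ‖γ s‖ = 1) :
    GU (γ 0) (covariantDerivAlong gU.leviCivita
        (fun s ↦ (extChartAt 𝓘(ℝ, V) u₀).symm (‖γ s‖⁻¹ • γ s))
        (fun s ↦ ((Real.sqrt (GU (((extChartAt 𝓘(ℝ, V) u₀).symm (‖γ s‖⁻¹ • γ s) : U) : V)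
          ((GU (((extChartAt 𝓘(ℝ, V) u₀).symm (‖γ s‖⁻¹ • γ s) : U) : V)).inverse
            (innerSL ℝ (((extChartAt 𝓘(ℝ, V) u₀).symm (‖γ s‖⁻¹ • γ s) : U) : V)))
          ((GU (((extChartAt 𝓘(ℝ, V) u₀).symm (‖γ s‖⁻¹ • γ s) : U) : V)).inverse
            (innerSL ℝ (((extChartAt 𝓘(ℝ, V) u₀).symm (‖γ s‖⁻¹ • γ s) : U) : V)))))⁻¹ •
          (GU (((extChartAt 𝓘(ℝ, V) u₀).symm (‖γ s‖⁻¹ • γ s) : U) : V)).inverse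
            (innerSL ℝ (((extChartAt 𝓘(ℝ, V) u₀).symm (‖γ s‖⁻¹ • γ s) : U) : V)) :
          TangentSpace 𝓘(ℝ, V) ((extChartAt 𝓘(ℝ, V) u₀).symm (‖γ s‖⁻¹ • γ s)))) 0) (γ' 0) =
      (Real.sqrt (GU (γ 0) ((GU (γ 0)).inverse (innerSL ℝ (γ 0)))
          ((GU (γ 0)).inverse (innerSL ℝ (γ 0)))))⁻¹ *
        (‖γ' 0‖ ^ 2 - ⟪γ 0, christoffel gU GU ((extChartAt 𝓘(ℝ, V) u₀).symm (‖γ 0‖⁻¹ • γ 0))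
          (γ' 0) (γ' 0)⟫) := by
  -- notation
  set ι : V → U := fun v ↦ (extChartAt 𝓘(ℝ, V) u₀).symm (‖v‖⁻¹ • v) with hι
  set Nr : V → V := fun v ↦ (GU v).inverse (innerSL ℝ v) with hNr
  set νf : V → V := fun v ↦ (Real.sqrt (GU v (Nr v) (Nr v)))⁻¹ • Nr v with hνf
  have hγ0 : ∀ s, γ s ≠ 0 := fun s h ↦ by
    have := hγn s; rw [h, norm_zero] at this; exact zero_ne_one this
  have hγc : ∀ s, ((ι (γ s) : U) : V) = γ s := fun s ↦ by
    show (((extChartAt 𝓘(ℝ, V) u₀).symm (‖γ s‖⁻¹ • γ s) : U) : V) = γ s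
    rw [coe_spherePresentation u₀ hSU (hγ0 s), hγn s, inv_one, one_smul]
  have hGd : ∀ y : U, DifferentiableAt ℝ GU y := fun y ↦
    (contDiffAt_metricComponents gU GU hG y).differentiableAt (by simp)
  -- the field along the curve is `νf ∘ γ`
  have hfield : (fun s ↦ νf ((ι (γ s) : U) : V)) = fun s ↦ νf (γ s) := funext fun s ↦ by rw [hγc s]
  -- `F = ‖·‖²`
  have hF : ContDiffAt ℝ 2 (fun y : V ↦ ‖y‖ ^ 2) (γ 0) := (contDiff_norm_sq ℝ).contDiffAt
  have hlevel : ∀ s, (fun y : V ↦ ‖y‖ ^ 2) (γ s) = (fun y : V ↦ ‖y‖ ^ 2) (γ 0) := fun s ↦ by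
    simp only [hγn]
  -- the normal field: derivative, orthogonality to the level set, non-degeneracy
  have hp0 : ((ι (γ 0) : U) : V) ≠ 0 := by rw [hγc 0]; exact hγ0 0
  have hνd : DifferentiableAt ℝ νf (γ 0) := by
    have h := (contDiffAt_sphereNormal gU GU hG hgU (ι (γ 0)) hp0).differentiableAt (by simp)
    rw [hγc 0] at h
    exact h
  have hN : HasDerivAt (fun s ↦ νf (γ s)) (fderiv ℝ νf (γ 0) (γ' 0)) 0 :=
    hνd.hasFDerivAt.comp_hasDerivAt (0 : ℝ) (hγ 0)
  -- `G_U(γ s)(νf (γ s), Z) = c ⟪γ s, Z⟫`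
  have hval : ∀ s (Z : V), GU (γ s) (νf (γ s)) Z =
      (Real.sqrt (GU (γ s) (Nr (γ s)) (Nr (γ s))))⁻¹ * ⟪γ s, Z⟫ := by
    intro s Z
    have h := val_sphereNormal gU GU hG (ι (γ s)) Z
    rw [hG (ι (γ s))] at h
    simp only [hγc s] at h
    exact h
  have hNperp : ∀ s, ∀ Z : V, fderiv ℝ (fun y : V ↦ ‖y‖ ^ 2) (γ s) Z = 0 →
      GU (γ s) (νf (γ s)) Z = 0 := by
    intro s Z hZ
    rw [fderiv_norm_sq_apply_apply] at hZ
    rw [hval s Z]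
    have : ⟪γ s, Z⟫ = 0 := by linarith
    rw [this, mul_zero]
  -- `q = G(N, N) = ⟪p, N⟫ > 0`
  set q : ℝ := GU (γ 0) (Nr (γ 0)) (Nr (γ 0)) with hq
  have hqpos : 0 < q := by
    have h := val_rawNormal_self_pos gU GU hG hgU (ι (γ 0)) hp0
    simp only [hγc 0] at h
    exact h
  have hsq : 0 < Real.sqrt q := Real.sqrt_pos.2 hqpos
  have hpN : ⟪γ 0, Nr (γ 0)⟫ = q := by
    have h := val_rawNormal gU GU hG (ι (γ 0)) (Nr (γ 0))
    rw [hG (ι (γ 0))] at h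
    simp only [hγc 0] at h
    exact h.symm
  have hdF : fderiv ℝ (fun y : V ↦ ‖y‖ ^ 2) (γ 0) (νf (γ 0)) = 2 * Real.sqrt q := by
    rw [fderiv_norm_sq_apply_apply]
    show 2 * ⟪γ 0, (Real.sqrt q)⁻¹ • Nr (γ 0)⟫ = 2 * Real.sqrt q
    rw [inner_smul_right, hpN]
    congr 1
    rw [inv_mul_eq_div, div_eq_iff hsq.ne', Real.mul_self_sqrt hqpos.le]
  have hm : fderiv ℝ (fun y : V ↦ ‖y‖ ^ 2) (γ 0) (νf (γ 0)) ≠ 0 := by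
    rw [hdF]; positivity
  have hunit : GU (γ 0) (νf (γ 0)) (νf (γ 0)) = 1 := by
    have h := val_sphereNormal_self gU GU hG hgU (ι (γ 0)) hp0
    rw [hG (ι (γ 0))] at h
    simp only [hγc 0] at h
    exact h
  -- the level-set formula
  have key := val_covariantDerivAlong_normal_velocity (g := gU) (G := GU) hG hGd
    (γ := fun s ↦ ι (γ s)) (c := γ) (c' := γ') (c'' := γ'') hγc hγ hγ'
    (F := fun y : V ↦ ‖y‖ ^ 2) hF hlevel (N := fun s ↦ νf (γ s)) hN hNperp hm
  rw [hunit, hdF, hessianForm_apply, fderiv_fderiv_norm_sq_apply, fderiv_norm_sq_apply_apply,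
    real_inner_self_eq_norm_sq] at key
  simp only [hγc 0] at key
  -- rewrite the field of the statement as `νf ∘ γ`
  have hfield' : (fun s ↦ (νf ((ι (γ s) : U) : V) : TangentSpace 𝓘(ℝ, V) (ι (γ s)))) =
      fun s ↦ (νf (γ s) : TangentSpace 𝓘(ℝ, V) (ι (γ s))) := hfield
  show GU (γ 0) (covariantDerivAlong gU.leviCivita (fun s ↦ ι (γ s))
      (fun s ↦ (νf ((ι (γ s) : U) : V) : TangentSpace 𝓘(ℝ, V) (ι (γ s)))) 0) (γ' 0) =
    (Real.sqrt q)⁻¹ * (‖γ' 0‖ ^ 2 - ⟪γ 0, christoffel gU GU (ι (γ 0)) (γ' 0) (γ' 0)⟫)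
  rw [hfield', key]
  field_simp

/-- **The curve form of `II ≥ -λ` for the round sphere** in the shape of hypothesis `hII` of
`ConeExitDerivative.neg_mul_val_le_half_deriv_coneMap` (`M := U`, presentation `ι(v) = φ⁻¹(v/‖v‖)`,
normal `ν ∘ ι`): if `⟪p, Γ_p(X)(X)⟫ ≤ λ √q(p) G_U(p)(X, X)` at all points of the unit sphere, then
for every `C^∞` curve `γ` on the sphere `-(λ g_U(X, X)) ≤ g_U(D_s(ν ∘ ι ∘ γ), X)`,
`X = d/ds ι(γ s)|₀`. [cite: Weinstein1968, proof of the main theorem, step (2)] -/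
theorem neg_mul_val_le_val_covariantDerivAlong_sphereNormal [gU.HasLeviCivita]
    (hG : ∀ y : U, gU.val y = GU y) (hgU : gU.IsRiemannian) (u₀ : U)
    (hSU : ∀ w : V, ‖w‖ = 1 → w ∈ U) {lam : ℝ}
    (hΓ : ∀ p : U, ‖(p : V)‖ = 1 → ∀ X : V,
      ⟪(p : V), christoffel gU GU p X X⟫ ≤
        lam * Real.sqrt (GU p ((GU p).inverse (innerSL ℝ (p : V))) ((GU p).inverse (innerSL ℝ (p : V)))) *
          GU p X X)
    (γ : ℝ → V) (hγs : ContDiff ℝ ∞ γ) (hγn : ∀ s, ‖γ s‖ = 1) :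
    -(lam * gU.val ((extChartAt 𝓘(ℝ, V) u₀).symm (‖γ 0‖⁻¹ • γ 0))
        (velocity 𝓘(ℝ, V) (fun s ↦ (extChartAt 𝓘(ℝ, V) u₀).symm (‖γ s‖⁻¹ • γ s)) 0)
        (velocity 𝓘(ℝ, V) (fun s ↦ (extChartAt 𝓘(ℝ, V) u₀).symm (‖γ s‖⁻¹ • γ s)) 0)) ≤
      gU.val ((extChartAt 𝓘(ℝ, V) u₀).symm (‖γ 0‖⁻¹ • γ 0))
        (covariantDerivAlong gU.leviCivita
          (fun s ↦ (extChartAt 𝓘(ℝ, V) u₀).symm (‖γ s‖⁻¹ • γ s))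
          (fun s ↦ ((Real.sqrt (GU (((extChartAt 𝓘(ℝ, V) u₀).symm (‖γ s‖⁻¹ • γ s) : U) : V)
            ((GU (((extChartAt 𝓘(ℝ, V) u₀).symm (‖γ s‖⁻¹ • γ s) : U) : V)).inverse
              (innerSL ℝ (((extChartAt 𝓘(ℝ, V) u₀).symm (‖γ s‖⁻¹ • γ s) : U) : V)))
            ((GU (((extChartAt 𝓘(ℝ, V) u₀).symm (‖γ s‖⁻¹ • γ s) : U) : V)).inverse
              (innerSL ℝ (((extChartAt 𝓘(ℝ, V) u₀).symm (‖γ s‖⁻¹ • γ s) : U) : V)))))⁻¹ •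
            (GU (((extChartAt 𝓘(ℝ, V) u₀).symm (‖γ s‖⁻¹ • γ s) : U) : V)).inverse
              (innerSL ℝ (((extChartAt 𝓘(ℝ, V) u₀).symm (‖γ s‖⁻¹ • γ s) : U) : V)) :
            TangentSpace 𝓘(ℝ, V) ((extChartAt 𝓘(ℝ, V) u₀).symm (‖γ s‖⁻¹ • γ s)))) 0)
        (velocity 𝓘(ℝ, V) (fun s ↦ (extChartAt 𝓘(ℝ, V) u₀).symm (‖γ s‖⁻¹ • γ s)) 0) := by
  set ι : V → U := fun v ↦ (extChartAt 𝓘(ℝ, V) u₀).symm (‖v‖⁻¹ • v) with hι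
  set Nr : V → V := fun v ↦ (GU v).inverse (innerSL ℝ v) with hNr
  have hγ : ∀ s, HasDerivAt γ (deriv γ s) s := fun s ↦
    ((hγs.differentiable (by simp)).differentiableAt).hasDerivAt
  have hγ' : HasDerivAt (deriv γ) (deriv (deriv γ) 0) 0 := by
    have h1 : ContDiff ℝ ∞ (deriv γ) := hγs.deriv'
    exact ((h1.differentiable (by simp)).differentiableAt).hasDerivAt
  have hγ0 : ∀ s, γ s ≠ 0 := fun s h ↦ by
    have := hγn s; rw [h, norm_zero] at this; exact zero_ne_one this
  have hγc : ∀ s, ((ι (γ s) : U) : V) = γ s := fun s ↦ by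
    show (((extChartAt 𝓘(ℝ, V) u₀).symm (‖γ s‖⁻¹ • γ s) : U) : V) = γ s
    rw [coe_spherePresentation u₀ hSU (hγ0 s), hγn s, inv_one, one_smul]
  have hvel : (velocity 𝓘(ℝ, V) (fun s ↦ ι (γ s)) 0 : V) = deriv γ 0 :=
    velocity_spherePresentation_comp u₀ hSU hγ hγn 0
  have key := val_covariantDerivAlong_sphereNormal gU GU hG hgU u₀ hSU hγ hγ' hγn
  set q : ℝ := GU (γ 0) (Nr (γ 0)) (Nr (γ 0)) with hq
  have hp0 : ((ι (γ 0) : U) : V) ≠ 0 := by rw [hγc 0]; exact hγ0 0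
  have hqpos : 0 < q := by
    have h := val_rawNormal_self_pos gU GU hG hgU (ι (γ 0)) hp0
    simp only [hγc 0] at h
    exact h
  have hsq : 0 < Real.sqrt q := Real.sqrt_pos.2 hqpos
  -- the hypothesis at `p = ι (γ 0)`
  have hΓ0 := hΓ (ι (γ 0)) (by rw [hγc 0]; exact hγn 0) (deriv γ 0)
  simp only [hγc 0] at hΓ0
  -- convert `gU.val` to components and the velocity to `γ' 0`
  rw [hvel]
  have e1 : ∀ a b : V, gU.val (ι (γ 0)) a b = GU (γ 0) a b := fun a b ↦ by
    have := DFunLike.congr_fun (DFunLike.congr_fun (hG (ι (γ 0))) a) b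
    rw [hγc 0] at this
    exact this
  rw [e1, e1, key]
  -- `-(lam G(X,X)) ≤ (√q)⁻¹ (‖X‖² - ⟪p, Γ(X,X)⟫)`
  have hX2 : 0 ≤ ‖deriv γ 0‖ ^ 2 := sq_nonneg _
  have h1 : ⟪γ 0, christoffel gU GU (ι (γ 0)) (deriv γ 0) (deriv γ 0)⟫ ≤
      lam * Real.sqrt q * GU (γ 0) (deriv γ 0) (deriv γ 0) := hΓ0
  rw [show (Real.sqrt q)⁻¹ * (‖deriv γ 0‖ ^ 2 -
      ⟪γ 0, christoffel gU GU (ι (γ 0)) (deriv γ 0) (deriv γ 0)⟫) =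
      (‖deriv γ 0‖ ^ 2 - ⟪γ 0, christoffel gU GU (ι (γ 0)) (deriv γ 0) (deriv γ 0)⟫) / Real.sqrt q
    from by rw [inv_mul_eq_div]]
  rw [le_div_iff₀ hsq]
  nlinarith [h1, hX2, hsq]

end Literature.Geometry.Riemannian

end
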